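import Mathlib.Analysis.Normed.Lp.lpSpace
import Literature.Barriers.CriticalPhenomena.WeaklySAWFlowLinearised
import HarnessLib

/-!
# [BBS-rg-flow, §3.2 and Lemma 4.3]: the weights `𝗐, 𝗏` of (3.2) and the solution operator
# `S̄_{𝒱𝒱}` as a bounded linear operator on `ℓ^∞` in scaled coordinates

Eighth file of the series formalising [BBS-rg-flow] (Bauerschmidt–Brydges–Slade, AHP 16 (2015),
arXiv:1211.2477), the abstract dynamical-system input of BBS 2015, Theorem 4.1 (via its Theorem 7.2.1),
towards `Literature.Barriers.CriticalPhenomena.WeaklySAWFourDimLogCorrections`; continuation of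
`WeaklySAWFlowLinearised.lean` (the componentwise solution `linG, linZ, linMu` of the linearised
equation `y_{j+1} = L_jy_j + r_j` and the weighted bounds of Lemma 4.3).

Design (Remark 3.2 of the source: only the decay encoded in the weights matters): instead of building
the weighted Banach spaces `X^𝗐, X^𝗏` of (3.1)–(3.2) as new normed spaces, we work in SCALED
coordinates `x_{α,j} = 𝗐_{α,j}x̃_{α,j}`, in which `X^𝗐 ≅ X^𝗏 ≅ ℓ^∞`; the `𝒱 = ℝ³`-part is Mathlib's
Banach space `lp (fun _ : ℕ => Fin 3 → ℝ) ∞` (`SeqV`). This file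
* defines the weights (3.2): `wG` (`𝗐_g = 𝗁g̊²|log g̊|`), `wZ` (`𝗐_z = 𝗐_μ = 𝗁χg̊²|log g̊|`),
  `vV` (`𝗏_g = 𝗏_z = 𝗏_μ = 𝗁χg̊³`), `wK` (`𝗐_K = 𝗏_K = (a-a_*)χg̊³`), and proves their positivity;
* proves that `S̄_{𝒱𝒱}` is LINEAR in the source (`linG_add/smul`, `linZ_add/smul`, `linMu_add/smul`:
  the series of (4.11) are additive under the summability given by Lemma 4.3);
* defines the scaled operator `sbarV` (`r̃ ↦ 𝗐⁻¹S̄_{𝒱𝒱}(𝗏r̃)`) and packages Lemma 4.3 as a bounded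
  linear operator `CutoffQuadHyp.sbarVCLM : SeqV →L[ℝ] SeqV` with `‖sbarVCLM‖ ≤ C_S̄ = max(C_g, C_z, C_μ)`
  (`norm_sbarVCLM_le`) — a constant depending only on `(Ω, c, N, C, λ)`, independent of `a`, `𝗁`,
  the cut-off and `g₀`, as printed in Lemma 4.3 (the factor `𝗁` cancels between `𝗏` and `𝗐`).

Deliberately NOT here: the `𝒦`-row of `S̄` (the shift `K_j = r^K_{j-1}`), Lemma 3.3, Lemmas 4.4–4.5,
Lemma 3.5.

## References
* R. Bauerschmidt, D. C. Brydges, G. Slade, *Structural stability of a dynamical system near a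
  non-hyperbolic fixed point*, Ann. Henri Poincaré 16 (2015), arXiv:1211.2477: §3.2 (3.1)–(3.2),
  Remark 3.2, Lemma 4.3 (4.12)–(4.13). [BauerschmidtBrydgesSlade2015Flow]
-/

noncomputable section

open Filter Topology Set
open scoped BigOperators ENNReal

namespace Literature.Barriers.CriticalPhenomena

namespace CTWSAW

/-! ## Linearity of the solution operator `S̄_{VV}` in the sources (Lemma 4.3: "`S̄` is a linear
solution operator") -/

namespace QuadFlowParams

variable (P : QuadFlowParams) (g₀ : ℝ)

/-- `g`-component: additivity in the source. [cite: BauerschmidtBrydgesSlade2015Flow, Lemma 4.3 ("the linear solution operator S̄")] -/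
theorem linG_add (rg rg' : ℕ → ℝ) (j : ℕ) :
    P.linG g₀ (fun l => rg l + rg' l) j = P.linG g₀ rg j + P.linG g₀ rg' j := by
  induction j with
  | zero => simp
  | succ j ih => simp only [linG_succ, ih]; ring

/-- `g`-component: homogeneity in the source. [cite: BauerschmidtBrydgesSlade2015Flow, Lemma 4.3] -/
theorem linG_smul (a : ℝ) (rg : ℕ → ℝ) (j : ℕ) :
    P.linG g₀ (fun l => a * rg l) j = a * P.linG g₀ rg j := by
  induction j with
  | zero => simp
  | succ j ih => simp only [linG_succ, ih]; ring

/-- The zero source gives the zero `g`-component. [cite: BauerschmidtBrydgesSlade2015Flow, Lemma 4.3] -/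
theorem linG_zero_src (j : ℕ) : P.linG g₀ (fun _ => 0) j = 0 := by
  induction j with
  | zero => simp
  | succ j ih => simp [linG_succ, ih]

end QuadFlowParams

namespace CutoffQuadHyp

variable {P : QuadFlowParams} {Ω : ℝ} {k : ℕ∞} {B c : ℝ} {N : ℕ} {C lam g₀ : ℝ}
  (h : CutoffQuadHyp P Ω k B c N C lam g₀)
include h

omit h in
/-- Sources bounded by `Rχ_lg̊_l³` are closed under addition (bound `R + R'`). [folklore] -/
theorem src_add_bound {r r' : ℕ → ℝ} {R R' : ℝ}
    (hr : ∀ l, |r l| ≤ R * (cutoffWeight Ω k l * gbar P.β g₀ l ^ 3))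
    (hr' : ∀ l, |r' l| ≤ R' * (cutoffWeight Ω k l * gbar P.β g₀ l ^ 3)) (l : ℕ) :
    |r l + r' l| ≤ (R + R') * (cutoffWeight Ω k l * gbar P.β g₀ l ^ 3) := by
  calc |r l + r' l| ≤ |r l| + |r' l| := abs_add_le _ _
    _ ≤ _ := by rw [add_mul]; exact add_le_add (hr l) (hr' l)

omit h in
/-- Sources bounded by `Rχ_lg̊_l³` are closed under scalar multiplication (bound `|a|R`). [folklore] -/
theorem src_smul_bound {r : ℕ → ℝ} {R : ℝ} (a : ℝ)
    (hr : ∀ l, |r l| ≤ R * (cutoffWeight Ω k l * gbar P.β g₀ l ^ 3)) (l : ℕ) :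
    |a * r l| ≤ |a| * R * (cutoffWeight Ω k l * gbar P.β g₀ l ^ 3) := by
  rw [abs_mul, mul_assoc]; exact mul_le_mul_of_nonneg_left (hr l) (abs_nonneg a)

/-- `z`-component: additivity in the sources. [cite: BauerschmidtBrydgesSlade2015Flow, Lemma 4.3 ("the linear solution operator S̄")] -/
theorem linZ_add (hsmall : 4 * g₀ ≤ Real.exp (-1)) {rg rz rg' rz' : ℕ → ℝ} {R R' : ℝ} (hR : 0 ≤ R) (hR' : 0 ≤ R')
    (hrg : ∀ l, |rg l| ≤ R * (cutoffWeight Ω k l * gbar P.β g₀ l ^ 3))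
    (hrz : ∀ l, |rz l| ≤ R * (cutoffWeight Ω k l * gbar P.β g₀ l ^ 3))
    (hrg' : ∀ l, |rg' l| ≤ R' * (cutoffWeight Ω k l * gbar P.β g₀ l ^ 3))
    (hrz' : ∀ l, |rz' l| ≤ R' * (cutoffWeight Ω k l * gbar P.β g₀ l ^ 3)) (j : ℕ) :
    P.linZ g₀ (fun l => rg l + rg' l) (fun l => rz l + rz' l) j = P.linZ g₀ rg rz j + P.linZ g₀ rg' rz' j := by
  have hs := h.summable_linZ_term hsmall hR hrg hrz j
  have hs' := h.summable_linZ_term hsmall hR' hrg' hrz' j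
  simp only [QuadFlowParams.linZ]
  rw [← neg_add, ← hs.tsum_add hs']
  congr 1
  refine tsum_congr fun l => ?_
  rw [P.linG_add]; ring

/-- `z`-component: homogeneity in the sources. [cite: BauerschmidtBrydgesSlade2015Flow, Lemma 4.3] -/
theorem linZ_smul (hsmall : 4 * g₀ ≤ Real.exp (-1)) {rg rz : ℕ → ℝ} {R : ℝ} (hR : 0 ≤ R)
    (hrg : ∀ l, |rg l| ≤ R * (cutoffWeight Ω k l * gbar P.β g₀ l ^ 3))
    (hrz : ∀ l, |rz l| ≤ R * (cutoffWeight Ω k l * gbar P.β g₀ l ^ 3)) (a : ℝ) (j : ℕ) :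
    P.linZ g₀ (fun l => a * rg l) (fun l => a * rz l) j = a * P.linZ g₀ rg rz j := by
  have hs := h.summable_linZ_term hsmall hR hrg hrz j
  simp only [QuadFlowParams.linZ]
  rw [mul_neg, ← hs.tsum_mul_left]
  congr 1
  refine tsum_congr fun l => ?_
  rw [P.linG_smul]; ring

/-- `μ`-component: additivity in the sources. [cite: BauerschmidtBrydgesSlade2015Flow, Lemma 4.3 ("the linear solution operator S̄")] -/
theorem linMu_add (hsmall : 4 * g₀ ≤ Real.exp (-1)) {rg rz rμ rg' rz' rμ' : ℕ → ℝ} {R R' : ℝ} (hR : 0 ≤ R)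
    (hR' : 0 ≤ R')
    (hrg : ∀ l, |rg l| ≤ R * (cutoffWeight Ω k l * gbar P.β g₀ l ^ 3))
    (hrz : ∀ l, |rz l| ≤ R * (cutoffWeight Ω k l * gbar P.β g₀ l ^ 3))
    (hrμ : ∀ l, |rμ l| ≤ R * (cutoffWeight Ω k l * gbar P.β g₀ l ^ 3))
    (hrg' : ∀ l, |rg' l| ≤ R' * (cutoffWeight Ω k l * gbar P.β g₀ l ^ 3))
    (hrz' : ∀ l, |rz' l| ≤ R' * (cutoffWeight Ω k l * gbar P.β g₀ l ^ 3))
    (hrμ' : ∀ l, |rμ' l| ≤ R' * (cutoffWeight Ω k l * gbar P.β g₀ l ^ 3)) (j : ℕ) :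
    P.linMu g₀ (fun l => rg l + rg' l) (fun l => rz l + rz' l) (fun l => rμ l + rμ' l) j =
      P.linMu g₀ rg rz rμ j + P.linMu g₀ rg' rz' rμ' j := by
  have hs := h.summable_linMu_term hsmall hR hrg hrz hrμ j
  have hs' := h.summable_linMu_term hsmall hR' hrg' hrz' hrμ' j
  simp only [QuadFlowParams.linMu]
  rw [← neg_add, ← hs.tsum_add hs']
  congr 1
  refine tsum_congr fun l => ?_
  rw [P.linG_add, h.linZ_add hsmall hR hR' hrg hrz hrg' hrz']; ring

/-- `μ`-component: homogeneity in the sources. [cite: BauerschmidtBrydgesSlade2015Flow, Lemma 4.3] -/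
theorem linMu_smul (hsmall : 4 * g₀ ≤ Real.exp (-1)) {rg rz rμ : ℕ → ℝ} {R : ℝ} (hR : 0 ≤ R)
    (hrg : ∀ l, |rg l| ≤ R * (cutoffWeight Ω k l * gbar P.β g₀ l ^ 3))
    (hrz : ∀ l, |rz l| ≤ R * (cutoffWeight Ω k l * gbar P.β g₀ l ^ 3))
    (hrμ : ∀ l, |rμ l| ≤ R * (cutoffWeight Ω k l * gbar P.β g₀ l ^ 3)) (a : ℝ) (j : ℕ) :
    P.linMu g₀ (fun l => a * rg l) (fun l => a * rz l) (fun l => a * rμ l) j = a * P.linMu g₀ rg rz rμ j := by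
  have hs := h.summable_linMu_term hsmall hR hrg hrz hrμ j
  simp only [QuadFlowParams.linMu]
  rw [mul_neg, ← hs.tsum_mul_left]
  congr 1
  refine tsum_congr fun l => ?_
  rw [P.linG_smul, h.linZ_smul hsmall hR hrg hrz]; ring

end CutoffQuadHyp


/-! ## The weights (3.2) and the scaled solution operator `S̄_{𝒱𝒱}` on `ℓ^∞(ℕ; ℝ³)` -/

open scoped ENNReal

/-- `ℓ^∞(ℕ; ℝ³)`: the `𝒱`-part of the spaces `X^𝗐 ≅ X^𝗏` of (3.1) in scaled coordinates
`x_{α,j} = 𝗐_{α,j}x̃_{α,j}`. [cite: BauerschmidtBrydgesSlade2015Flow, §3.2, (3.1) and Remark 3.2] -/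
abbrev SeqV : Type := ↥(lp (fun _ : ℕ => V3) ∞)

namespace QuadFlowParams

variable (P : QuadFlowParams) (g₀ : ℝ)

/-- The weight `𝗐_{g,j} = 𝗁 g̊_j²|log g̊_j|` of (3.2) (`g̊ = ḡ(g̊₀)` the base flow).
[cite: BauerschmidtBrydgesSlade2015Flow, §3.2, (3.2)] -/
def wG (hh : ℝ) (j : ℕ) : ℝ := hh * (gbar P.β g₀ j ^ 2 * |Real.log (gbar P.β g₀ j)|)

/-- The weight `𝗐_{z,j} = 𝗐_{μ,j} = 𝗁χ_jg̊_j²|log g̊_j|` of (3.2). [cite: BauerschmidtBrydgesSlade2015Flow, §3.2, (3.2)] -/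
def wZ (Ω : ℝ) (k : ℕ∞) (hh : ℝ) (j : ℕ) : ℝ :=
  hh * (cutoffWeight Ω k j * gbar P.β g₀ j ^ 2 * |Real.log (gbar P.β g₀ j)|)

/-- The weight `𝗏_{g,j} = 𝗏_{z,j} = 𝗏_{μ,j} = 𝗁χ_jg̊_j³` of (3.2). [cite: BauerschmidtBrydgesSlade2015Flow, §3.2, (3.2)] -/
def vV (Ω : ℝ) (k : ℕ∞) (hh : ℝ) (j : ℕ) : ℝ := hh * (cutoffWeight Ω k j * gbar P.β g₀ j ^ 3)

/-- The weight `𝗐_{K,j} = 𝗏_{K,j} = (a - a_*)χ_jg̊_j³` of (3.2). [cite: BauerschmidtBrydgesSlade2015Flow, §3.2, (3.2)] -/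
def wK (Ω : ℝ) (k : ℕ∞) (aK : ℝ) (j : ℕ) : ℝ := aK * (cutoffWeight Ω k j * gbar P.β g₀ j ^ 3)

/-- The solution operator `S̄_{𝒱𝒱}` of Lemma 4.3 in scaled coordinates: `r̃ ↦ 𝗐⁻¹ · S̄_{𝒱𝒱}(𝗏 · r̃)`,
i.e. the source `r_{α,l} = 𝗏_{α,l} r̃_{α,l}` is fed into `(linG, linZ, linMu)` and the solution is divided
by the weights `𝗐`. [cite: BauerschmidtBrydgesSlade2015Flow, Lemma 4.3, (4.12)–(4.13)] -/
def sbarV (Ω : ℝ) (k : ℕ∞) (hh : ℝ) (r : ℕ → V3) (j : ℕ) : V3 :=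
  ![P.linG g₀ (fun l => P.vV g₀ Ω k hh l * r l 0) j / P.wG g₀ hh j,
    P.linZ g₀ (fun l => P.vV g₀ Ω k hh l * r l 0) (fun l => P.vV g₀ Ω k hh l * r l 1) j / P.wZ g₀ Ω k hh j,
    P.linMu g₀ (fun l => P.vV g₀ Ω k hh l * r l 0) (fun l => P.vV g₀ Ω k hh l * r l 1)
      (fun l => P.vV g₀ Ω k hh l * r l 2) j / P.wZ g₀ Ω k hh j]

/-- Unfolding of the `g`-coordinate of the scaled `S̄_{𝒱𝒱}`. [cite: BauerschmidtBrydgesSlade2015Flow, Lemma 4.3, (4.13)] -/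
@[simp] theorem sbarV_apply_zero (Ω : ℝ) (k : ℕ∞) (hh : ℝ) (r : ℕ → V3) (j : ℕ) :
    P.sbarV g₀ Ω k hh r j 0 = P.linG g₀ (fun l => P.vV g₀ Ω k hh l * r l 0) j / P.wG g₀ hh j := rfl

/-- Unfolding of the `z`-coordinate of the scaled `S̄_{𝒱𝒱}`. [cite: BauerschmidtBrydgesSlade2015Flow, Lemma 4.3, (4.13)] -/
@[simp] theorem sbarV_apply_one (Ω : ℝ) (k : ℕ∞) (hh : ℝ) (r : ℕ → V3) (j : ℕ) :
    P.sbarV g₀ Ω k hh r j 1 =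
      P.linZ g₀ (fun l => P.vV g₀ Ω k hh l * r l 0) (fun l => P.vV g₀ Ω k hh l * r l 1) j / P.wZ g₀ Ω k hh j := rfl

/-- Unfolding of the `μ`-coordinate of the scaled `S̄_{𝒱𝒱}`. [cite: BauerschmidtBrydgesSlade2015Flow, Lemma 4.3, (4.13)] -/
@[simp] theorem sbarV_apply_two (Ω : ℝ) (k : ℕ∞) (hh : ℝ) (r : ℕ → V3) (j : ℕ) :
    P.sbarV g₀ Ω k hh r j 2 =
      P.linMu g₀ (fun l => P.vV g₀ Ω k hh l * r l 0) (fun l => P.vV g₀ Ω k hh l * r l 1)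
        (fun l => P.vV g₀ Ω k hh l * r l 2) j / P.wZ g₀ Ω k hh j := rfl

end QuadFlowParams

/-- The constant `C_S̄ = max(C_g, C_z, C_μ)` of Lemma 4.3. [cite: BauerschmidtBrydgesSlade2015Flow, Lemma 4.3] -/
def sbarConst (Ω c : ℝ) (N : ℕ) (C lam : ℝ) : ℝ :=
  max (linGConst Ω c N) (max (linZConst Ω c N C) (linMuConst Ω c N C lam))

/-- A vector of `ℝ³` is bounded in norm by a bound on its three coordinates. [folklore] -/
theorem norm_V3_le {x : V3} {M : ℝ} (hM : 0 ≤ M) (h0 : |x 0| ≤ M) (h1 : |x 1| ≤ M) (h2 : |x 2| ≤ M) :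
    ‖x‖ ≤ M := by
  refine (pi_norm_le_iff_of_nonneg hM).2 fun i => ?_
  fin_cases i <;> simpa [Real.norm_eq_abs]

/-- Coordinates of an element of `ℓ^∞(ℕ; ℝ³)` are bounded by its norm. [folklore] -/
theorem abs_apply_le_norm_seqV (r : SeqV) (l : ℕ) (i : Fin 3) : |r l i| ≤ ‖r‖ :=
  ((Real.norm_eq_abs _).symm.le.trans (norm_le_pi_norm (r l) i)).trans
    (lp.norm_apply_le_norm ENNReal.top_ne_zero r l)

namespace CutoffQuadHyp

variable {P : QuadFlowParams} {Ω : ℝ} {k : ℕ∞} {B c : ℝ} {N : ℕ} {C lam g₀ : ℝ}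
  (h : CutoffQuadHyp P Ω k B c N C lam g₀)
include h

/-- `𝗐_{g,j} > 0` for `𝗁 > 0`. [cite: BauerschmidtBrydgesSlade2015Flow, §3.2] -/
theorem wG_pos {hh : ℝ} (hh0 : 0 < hh) (j : ℕ) : 0 < P.wG g₀ hh j := by
  have := h.gbar_pos j; have := h.toCutoffGbarHyp.half_le_abs_log_gbar j
  unfold QuadFlowParams.wG; positivity

/-- `𝗐_{z,j} > 0` for `𝗁 > 0`. [cite: BauerschmidtBrydgesSlade2015Flow, §3.2] -/
theorem wZ_pos {hh : ℝ} (hh0 : 0 < hh) (j : ℕ) : 0 < P.wZ g₀ Ω k hh j := by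
  have := h.gbar_pos j; have := h.toCutoffGbarHyp.half_le_abs_log_gbar j; have := h.weight_pos j
  unfold QuadFlowParams.wZ; positivity

/-- `𝗏_{α,j} > 0` for `𝗁 > 0`. [cite: BauerschmidtBrydgesSlade2015Flow, §3.2] -/
theorem vV_pos {hh : ℝ} (hh0 : 0 < hh) (j : ℕ) : 0 < P.vV g₀ Ω k hh j := by
  have := h.gbar_pos j; have := h.weight_pos j
  unfold QuadFlowParams.vV; positivity

/-- `𝗐_{K,j} > 0` for `a - a_* > 0`. [cite: BauerschmidtBrydgesSlade2015Flow, §3.2] -/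
theorem wK_pos {aK : ℝ} (haK : 0 < aK) (j : ℕ) : 0 < P.wK g₀ Ω k aK j := by
  have := h.gbar_pos j; have := h.weight_pos j
  unfold QuadFlowParams.wK; positivity

/-- A bounded scaled source gives a physical source with `|r_{α,l}| ≤ (𝗁M)χ_lg̊_l³`.
[cite: BauerschmidtBrydgesSlade2015Flow, §3.2, (3.1)–(3.2)] -/
theorem abs_vV_mul_le {hh : ℝ} (hh0 : 0 < hh) {r : ℕ → V3} {M : ℝ} (hr : ∀ l i, |r l i| ≤ M)
    (i : Fin 3) (l : ℕ) :
    |P.vV g₀ Ω k hh l * r l i| ≤ hh * M * (cutoffWeight Ω k l * gbar P.β g₀ l ^ 3) := by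
  have hv := (h.vV_pos hh0 l).le
  rw [abs_mul, abs_of_nonneg hv, QuadFlowParams.vV]
  calc hh * (cutoffWeight Ω k l * gbar P.β g₀ l ^ 3) * |r l i|
      = hh * |r l i| * (cutoffWeight Ω k l * gbar P.β g₀ l ^ 3) := by ring
    _ ≤ hh * M * (cutoffWeight Ω k l * gbar P.β g₀ l ^ 3) := by
        have := (h.weight_pos l).le; have := (h.gbar_pos l).le
        gcongr; exact hr l i

/-- `C_S̄ ≥ 0`. [cite: BauerschmidtBrydgesSlade2015Flow, Lemma 4.3] -/
theorem sbarConst_nonneg : 0 ≤ sbarConst Ω c N C lam :=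
  le_max_of_le_left h.linGConst_nonneg

/-- **[BBS-rg-flow, Lemma 4.3, (4.12)] coordinatewise in scaled form**: for a scaled source bounded by
`M`, every coordinate of `S̄_{𝒱𝒱}r̃` is bounded by `C_S̄ M` (the factor `𝗁` cancels between `𝗏` and `𝗐`).
[cite: BauerschmidtBrydgesSlade2015Flow, Lemma 4.3, (4.12)] -/
theorem norm_sbarV_apply_le (hsmall : 4 * g₀ ≤ Real.exp (-1)) {hh : ℝ} (hh0 : 0 < hh) {r : ℕ → V3} {M : ℝ}
    (hM : 0 ≤ M) (hr : ∀ l i, |r l i| ≤ M) (j : ℕ) :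
    ‖P.sbarV g₀ Ω k hh r j‖ ≤ sbarConst Ω c N C lam * M := by
  have hR : 0 ≤ hh * M := by positivity
  obtain ⟨-, -, hb⟩ := h.linSol_spec hsmall hR (h.abs_vV_mul_le hh0 hr 0) (h.abs_vV_mul_le hh0 hr 1)
    (h.abs_vV_mul_le hh0 hr 2)
  obtain ⟨hg, hz, hμ⟩ := hb j
  have hwG := h.wG_pos hh0 j; have hwZ := h.wZ_pos hh0 j
  have hS := h.sbarConst_nonneg
  have hCg : linGConst Ω c N ≤ sbarConst Ω c N C lam := le_max_left _ _
  have hCz : linZConst Ω c N C ≤ sbarConst Ω c N C lam := (le_max_left _ _).trans (le_max_right _ _)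
  have hCμ : linMuConst Ω c N C lam ≤ sbarConst Ω c N C lam := (le_max_right _ _).trans (le_max_right _ _)
  refine norm_V3_le (by positivity) ?_ ?_ ?_
  · rw [P.sbarV_apply_zero, abs_div, abs_of_pos hwG, div_le_iff₀ hwG]
    refine hg.trans ?_
    rw [QuadFlowParams.wG]
    calc linGConst Ω c N * (hh * M) * (gbar P.β g₀ j ^ 2 * |Real.log (gbar P.β g₀ j)|)
        = linGConst Ω c N * M * (hh * (gbar P.β g₀ j ^ 2 * |Real.log (gbar P.β g₀ j)|)) := by ring
      _ ≤ sbarConst Ω c N C lam * M * (hh * (gbar P.β g₀ j ^ 2 * |Real.log (gbar P.β g₀ j)|)) := by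
          gcongr
  · rw [P.sbarV_apply_one, abs_div, abs_of_pos hwZ, div_le_iff₀ hwZ]
    refine hz.trans ?_
    rw [QuadFlowParams.wZ]
    calc linZConst Ω c N C * (hh * M) * (cutoffWeight Ω k j * gbar P.β g₀ j ^ 2 * |Real.log (gbar P.β g₀ j)|)
        = linZConst Ω c N C * M *
            (hh * (cutoffWeight Ω k j * gbar P.β g₀ j ^ 2 * |Real.log (gbar P.β g₀ j)|)) := by ring
      _ ≤ sbarConst Ω c N C lam * M *
            (hh * (cutoffWeight Ω k j * gbar P.β g₀ j ^ 2 * |Real.log (gbar P.β g₀ j)|)) := by gcongr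
  · rw [P.sbarV_apply_two, abs_div, abs_of_pos hwZ, div_le_iff₀ hwZ]
    refine hμ.trans ?_
    rw [QuadFlowParams.wZ]
    calc linMuConst Ω c N C lam * (hh * M) *
          (cutoffWeight Ω k j * gbar P.β g₀ j ^ 2 * |Real.log (gbar P.β g₀ j)|)
        = linMuConst Ω c N C lam * M *
            (hh * (cutoffWeight Ω k j * gbar P.β g₀ j ^ 2 * |Real.log (gbar P.β g₀ j)|)) := by ring
      _ ≤ sbarConst Ω c N C lam * M *
            (hh * (cutoffWeight Ω k j * gbar P.β g₀ j ^ 2 * |Real.log (gbar P.β g₀ j)|)) := by gcongr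

/-- `S̄_{𝒱𝒱}` maps `ℓ^∞` to `ℓ^∞`. [cite: BauerschmidtBrydgesSlade2015Flow, Lemma 4.3] -/
theorem memℓp_sbarV (hsmall : 4 * g₀ ≤ Real.exp (-1)) {hh : ℝ} (hh0 : 0 < hh) (r : SeqV) :
    Memℓp (P.sbarV g₀ Ω k hh r) ∞ :=
  memℓp_infty ⟨sbarConst Ω c N C lam * ‖r‖, by
    rintro _ ⟨j, rfl⟩
    exact h.norm_sbarV_apply_le hsmall hh0 (norm_nonneg r) (fun l i => abs_apply_le_norm_seqV r l i) j⟩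

/-- Additivity of the scaled `S̄_{𝒱𝒱}` on `ℓ^∞`. [cite: BauerschmidtBrydgesSlade2015Flow, Lemma 4.3 ("linear solution operator")] -/
theorem sbarV_add (hsmall : 4 * g₀ ≤ Real.exp (-1)) {hh : ℝ} (hh0 : 0 < hh) (r r' : SeqV) (j : ℕ) :
    P.sbarV g₀ Ω k hh (fun l => r l + r' l) j = P.sbarV g₀ Ω k hh r j + P.sbarV g₀ Ω k hh r' j := by
  have hR : 0 ≤ hh * ‖r‖ := by positivity
  have hR' : 0 ≤ hh * ‖r'‖ := by positivity
  have hb := fun i => h.abs_vV_mul_le hh0 (fun l i => abs_apply_le_norm_seqV r l i) i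
  have hb' := fun i => h.abs_vV_mul_le hh0 (fun l i => abs_apply_le_norm_seqV r' l i) i
  ext i
  fin_cases i
  · simp only [Fin.zero_eta, Fin.isValue, P.sbarV_apply_zero, Pi.add_apply, mul_add]
    rw [P.linG_add, add_div]
  · simp only [Fin.mk_one, Fin.isValue, P.sbarV_apply_one, Pi.add_apply, mul_add]
    rw [h.linZ_add hsmall hR hR' (hb 0) (hb 1) (hb' 0) (hb' 1), add_div]
  · simp only [Fin.reduceFinMk, Fin.isValue, P.sbarV_apply_two, Pi.add_apply, mul_add]
    rw [h.linMu_add hsmall hR hR' (hb 0) (hb 1) (hb 2) (hb' 0) (hb' 1) (hb' 2), add_div]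

/-- Homogeneity of the scaled `S̄_{𝒱𝒱}` on `ℓ^∞`. [cite: BauerschmidtBrydgesSlade2015Flow, Lemma 4.3 ("linear solution operator")] -/
theorem sbarV_smul (hsmall : 4 * g₀ ≤ Real.exp (-1)) {hh : ℝ} (hh0 : 0 < hh) (a : ℝ) (r : SeqV) (j : ℕ) :
    P.sbarV g₀ Ω k hh (fun l => a • r l) j = a • P.sbarV g₀ Ω k hh r j := by
  have hR : 0 ≤ hh * ‖r‖ := by positivity
  have hb := fun i => h.abs_vV_mul_le hh0 (fun l i => abs_apply_le_norm_seqV r l i) i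
  have hcomm : ∀ i, (fun l => P.vV g₀ Ω k hh l * (a * r l i)) = fun l => a * (P.vV g₀ Ω k hh l * r l i) := by
    intro i; funext l; ring
  ext i
  fin_cases i
  · simp only [Fin.zero_eta, Fin.isValue, P.sbarV_apply_zero, Pi.smul_apply, smul_eq_mul]
    rw [hcomm 0, P.linG_smul, mul_div_assoc]
  · simp only [Fin.mk_one, Fin.isValue, P.sbarV_apply_one, Pi.smul_apply, smul_eq_mul]
    rw [hcomm 0, hcomm 1, h.linZ_smul hsmall hR (hb 0) (hb 1), mul_div_assoc]
  · simp only [Fin.reduceFinMk, Fin.isValue, P.sbarV_apply_two, Pi.smul_apply, smul_eq_mul]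
    rw [hcomm 0, hcomm 1, hcomm 2, h.linMu_smul hsmall hR (hb 0) (hb 1) (hb 2), mul_div_assoc]

/-- `S̄_{𝒱𝒱}` as a linear map on `ℓ^∞(ℕ; ℝ³)` (scaled coordinates). [cite: BauerschmidtBrydgesSlade2015Flow, Lemma 4.3] -/
def sbarVLin (hsmall : 4 * g₀ ≤ Real.exp (-1)) {hh : ℝ} (hh0 : 0 < hh) : SeqV →ₗ[ℝ] SeqV where
  toFun r := ⟨P.sbarV g₀ Ω k hh r, h.memℓp_sbarV hsmall hh0 r⟩
  map_add' r r' := by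
    ext j : 2
    simp only [lp.coeFn_add, Pi.add_apply]
    rw [← h.sbarV_add hsmall hh0 r r' j]
    rfl
  map_smul' a r := by
    ext j : 2
    simp only [lp.coeFn_smul, Pi.smul_apply, RingHom.id_apply]
    rw [← h.sbarV_smul hsmall hh0 a r j]
    rfl

/-- Unfolding. [cite: BauerschmidtBrydgesSlade2015Flow, Lemma 4.3] -/
theorem sbarVLin_apply (hsmall : 4 * g₀ ≤ Real.exp (-1)) {hh : ℝ} (hh0 : 0 < hh) (r : SeqV) (j : ℕ) :
    (h.sbarVLin hsmall hh0 r : ℕ → V3) j = P.sbarV g₀ Ω k hh r j := rfl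

/-- **[BBS-rg-flow, Lemma 4.3]**: `S̄_{𝒱𝒱} : X^𝗏 → X^𝗐` is a bounded linear operator (here on `ℓ^∞` in
scaled coordinates), with bound `C_S̄` independent of `a`, `𝗁`, the cut-off and `g₀`.
[cite: BauerschmidtBrydgesSlade2015Flow, Lemma 4.3, (4.12)] -/
def sbarVCLM (hsmall : 4 * g₀ ≤ Real.exp (-1)) {hh : ℝ} (hh0 : 0 < hh) : SeqV →L[ℝ] SeqV :=
  (h.sbarVLin hsmall hh0).mkContinuous (sbarConst Ω c N C lam) fun r =>
    lp.norm_le_of_forall_le (mul_nonneg h.sbarConst_nonneg (norm_nonneg r)) fun j =>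
      h.norm_sbarV_apply_le hsmall hh0 (norm_nonneg r) (fun l i => abs_apply_le_norm_seqV r l i) j

/-- Unfolding. [cite: BauerschmidtBrydgesSlade2015Flow, Lemma 4.3] -/
theorem sbarVCLM_apply (hsmall : 4 * g₀ ≤ Real.exp (-1)) {hh : ℝ} (hh0 : 0 < hh) (r : SeqV) (j : ℕ) :
    (h.sbarVCLM hsmall hh0 r : ℕ → V3) j = P.sbarV g₀ Ω k hh r j := rfl

/-- **[BBS-rg-flow, Lemma 4.3, (4.12)]**: `‖S̄_{𝒱𝒱}‖ ≤ C_S̄`. [cite: BauerschmidtBrydgesSlade2015Flow, Lemma 4.3, (4.12)] -/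
theorem norm_sbarVCLM_le (hsmall : 4 * g₀ ≤ Real.exp (-1)) {hh : ℝ} (hh0 : 0 < hh) :
    ‖h.sbarVCLM hsmall hh0‖ ≤ sbarConst Ω c N C lam :=
  LinearMap.mkContinuous_norm_le _ h.sbarConst_nonneg _

end CutoffQuadHyp


end CTWSAW

end Literature.Barriers.CriticalPhenomena
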